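import Summits.HodgeConjecture.HodgeConjecture.Theorems.Ring2AbelianAllWeilDefiniteSplitting
import Literature.NumberTheory.QuadraticForms.LandherrHermitianMatrices
import Literature.AlgebraicGeometry.Motives.AimedSplitProductDischarge
import HarnessLib

/-!
# Ring 2 · AbelianAll (ab-weil-1, gen 10, part 8) — Landherr UNIQUENESS on the carriers: two Weil-type
  members of the same discriminant cell `δ` have congruent Hermitian Gram matrices over `K_d`

research route, not a corollary; conditional on HC_CM plus one named minimal statement.
Cell line: research route conditional on HC_CM; not a corollary; Q11.4-sentence-2 already refuted in dim ≥ 3.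
`HC_CM` (`Theses.RankFourFaces.CMAbelianHodge`) does not occur in this file and no open case of the Hodge
conjecture is claimed.  The inputs are: the Hodge–Riemann bilinear relation in degree one (through part 8b,
`Ring2AbelianAllWeilDefiniteSplitting`), Landherr's classification of Hermitian forms over a CM field (the
tree's `Literature.NumberTheory.QuadraticForms.hermitianMatrices_congruent_iff_invariants_fin`, Landherr
1936 — proved there, used here BY NAME, count-once), and the arithmetic of `K_d = ℚ[X]/(X² + d)` (part 8a,
`Ring2AbelianAllWeilFieldCM`).

## What is proved (0 sorry)

Van Geemen (LNM 1594, Lemma 5.2 (3)–(4) and (5.4.1), after Landherr): the isomorphism class of the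
Hermitian `K`-form `H = E(x, √-d y) + √-d E(x, y)` of a `2n`-dimensional polarized abelian variety of Weil
type `(X, K = ℚ(√-d), E)` is determined by its signature — always `(n, n)` — and its discriminant
`det H ∈ ℚ^×/Nm(K^×)`; hence ("(5.4.1) … classified by `ℋ_n ≅ ℚ^×/Nm(K^×)`") TWO MEMBERS WITH THE SAME
DISCRIMINANT CLASS `δ` HAVE ISOMETRIC HERMITIAN FORMS.  On the carriers of the tree (the Gram-matrix
witnesses `Ψ = a + b√-d ∈ M_{2n}(K_d)` of `VanGeemen1994.HasWeilDiscriminantNondeg`):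

* §3 INERTIA over `ℂ` (`card_pos_eigenvalues_eq_finrank_of_definite`): a Hermitian complex matrix positive
  definite on `P` and negative definite on `N`, `P ⊕ N = ℂ^ι`, has exactly `dim P` positive eigenvalues
  (spectral theorem + a kernel-vector count, `finrank_le_card_pos_re_of_pos_on`).
* §4 SIGNATURE `(n, n)` AT EVERY COMPLEX EMBEDDING in Landherr's format (`card_pos_eigenvalues_map_weilGram`):
  for `(A, φ)` with Weil multiplicities `(n, n)` and any `τ : K_d →+* ℂ` the Hermitian complex matrix `τ(Ψ)`
  has exactly `n` positive eigenvalues (part 8b's definite splitting + §3); and for `HodgeTheory.IsWeilType`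
  data the conjugate multiplicity is automatic (`weilMultiplicity_neg_of_isWeilType`).
* §6 **UNIQUENESS** (`exists_gl_conjTranspose_mul_weilGram_mul_eq`): for two members `(A, φ, h_K)`,
  `(A', φ', h'_K)` of Weil type `(n, d)` (`h_K = d·e^*a + φ^*e^*a`) and Gram witnesses `Ψ`, `Ψ'` of the SAME
  class `δ ∈ ℚ^×/Nm(K_d^×)`, there is `g ∈ GL_{2n}(K_d)` with `ᵗ(σg) · Ψ · g = Ψ'`.

This is the fourth leg of van Geemen's Lemma 5.2 / (5.4.1) on the carriers (existence of a witness: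
`Ring2AbelianAllWeilDiscriminantDescent` + `VanGeemen1994.exists_hasWeilDiscriminantNondeg`;
multiplicativity: `Ring2AbelianAllWeilDiscriminantProduct`; sign: `Ring2AbelianAllWeilSignature`;
uniqueness: this file).  It is the matrix-level input for "same `δ` ⟹ `Motives.IsWeilSimilar`" (part 9),
which plugs the `δ`-cells of the atlas into the tree's kernel-checked anchor engine
(`WeilTypeLadder.weilClassesOf_le_algebraicClasses_of_reachSimilar_of_similarAnchor`, whose print input is
the refereed named fact `HodgeTheory.weilFamilyReach_similar`, Deligne LNM 900, proof of Thm. 4.8).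

What is NOT proved or claimed: that the discriminant cells are the connected components of a moduli space,
any instance of the variational Hodge conjecture, algebraicity of any Weil class.  No Literature fact is
introduced; no internally-minted statement is cited as a fact.

## References

* [vanGeemen1994HodgeAV] B. van Geemen, An introduction to the Hodge conjecture for abelian varieties,
  LNM 1594 (1994), 4.9, 4.14, Lemma 5.2 (1)–(4), 5.3, (5.4.1).
* [Landherr1936HermitianForms] W. Landherr, Äquivalenz Hermitescher Formen über einen beliebigen
  algebraischen Zahlkörper, Abh. Math. Sem. Hamburg 11 (1936) 245–248 (modern account: G. Shimura,
  Arithmetic of Hermitian forms, Doc. Math. 13 (2008), Thm. 2.2 (i)).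
* [Deligne1982HodgeCycles] P. Deligne, Hodge cycles on abelian varieties, LNM 900, proof of Thm. 4.8.
* [VoisinHodgeI2002] C. Voisin, Hodge Theory and Complex Algebraic Geometry I, Thm. 6.32.
-/

noncomputable section

set_option linter.dupNamespace false

open CategoryTheory Polynomial NumberField
open Literature.AlgebraicGeometry Literature.AlgebraicGeometry.Motives
open Literature.AlgebraicGeometry.HodgeTheory
open Literature.AlgebraicGeometry.VanGeemen1994
open Literature.AlgebraicTopology.SingularHomology
open Literature.NumberTheory.QuadraticForms

namespace Summit.HodgeConjecture.HodgeConjecture.Ring2.AbelianAll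

/-! ### §3 Inertia: a Hermitian matrix definite of opposite signs on a splitting `P ⊕ N` has `dim P` positive
  eigenvalues -/

section Inertia

open Matrix
open Literature.NumberTheory.QuadraticForms.Landherr (realQ re_star_dotProduct_diagonal_mulVec)

variable {ι : Type} [Fintype ι] [DecidableEq ι]

/-- **The kernel-vector inequality.**  If `Uᴴ A U = diag t` with `U Uᴴ = 1` and `Re(p* A p) > 0` on a
subspace `P ∖ 0`, then `dim P ≤ #{i | Re tᵢ > 0}`: otherwise some `p ∈ P ∖ 0` has `Uᴴ p` supported off the
positive coordinates, where the diagonal form is `≤ 0`. [cite: Landherr1936HermitianForms] -/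
theorem finrank_le_card_pos_re_of_pos_on {A U : Matrix ι ι ℂ} {t : ι → ℂ}
    (hU : Uᴴ * A * U = Matrix.diagonal t) (hUU : U * Uᴴ = 1) {P : Submodule ℂ (ι → ℂ)}
    (hpos : ∀ p ∈ P, p ≠ 0 → 0 < (star p ⬝ᵥ A *ᵥ p).re) :
    Module.finrank ℂ P ≤ (Finset.univ.filter fun i => 0 < (t i).re).card := by
  classical
  set S : Finset ι := Finset.univ.filter fun i => 0 < (t i).re with hS
  have memS : ∀ i, i ∈ S ↔ 0 < (t i).re := fun i => by rw [hS]; simp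
  by_contra hlt
  rw [not_le] at hlt
  -- the linear map `p ↦ (Uᴴ p)|_S` from `P` to `ℂ^S` has a kernel vector
  let ψ : P →ₗ[ℂ] ({i // i ∈ S} → ℂ) :=
    (LinearMap.funLeft ℂ ℂ (Subtype.val : {i // i ∈ S} → ι)) ∘ₗ Uᴴ.mulVecLin ∘ₗ P.subtype
  have hdim : Module.finrank ℂ ({i // i ∈ S} → ℂ) < Module.finrank ℂ P := by
    rw [Module.finrank_fintype_fun_eq_card, Fintype.card_coe]; exact hlt
  obtain ⟨p, hp, hp0⟩ := (Submodule.ne_bot_iff _).mp (LinearMap.ker_ne_bot_of_finrank_lt (f := ψ) hdim)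
  rw [LinearMap.mem_ker] at hp
  set w : ι → ℂ := Uᴴ *ᵥ (p : ι → ℂ) with hw
  have hwS : ∀ i, i ∈ S → w i = 0 := by
    intro i hi
    have h := congrFun hp ⟨i, hi⟩
    rw [hw]
    simpa [ψ, LinearMap.funLeft_apply] using h
  have hUw : U *ᵥ w = (p : ι → ℂ) := by rw [hw, Matrix.mulVec_mulVec, hUU, Matrix.one_mulVec]
  -- the form at `p` is the diagonal form at `w`, which is `≤ 0`
  have hre : (star (p : ι → ℂ) ⬝ᵥ A *ᵥ (p : ι → ℂ)).re = realQ t w := by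
    rw [← re_star_dotProduct_diagonal_mulVec, ← hU, ← hUw, Matrix.star_mulVec, ← Matrix.dotProduct_mulVec,
      Matrix.mulVec_mulVec, Matrix.mulVec_mulVec]
  have hle : realQ t w ≤ 0 := by
    refine Finset.sum_nonpos fun i _ => ?_
    by_cases hi : i ∈ S
    · rw [hwS i hi]; simp
    · have hti : (t i).re ≤ 0 := not_lt.mp fun h => hi ((memS i).mpr h)
      exact mul_nonpos_of_nonpos_of_nonneg hti (by positivity)
  have hp0' : (p : ι → ℂ) ≠ 0 := fun h => hp0 (Subtype.ext h)
  have hgt := hpos (p : ι → ℂ) p.2 hp0'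
  rw [hre] at hgt
  exact absurd hle (not_le.mpr hgt)

/-- **Inertia, eigenvalue count.**  A Hermitian complex matrix `A` which is positive definite on `P` and
negative definite on `N`, `P ⊕ N = ℂ^ι`, has exactly `dim P` positive eigenvalues (Sylvester; the spectral
theorem `Uᴴ A U = diag λ` and the kernel-vector inequality applied to `A` on `P` and to `-A` on `N`).
[cite: Landherr1936HermitianForms] -/
theorem card_pos_eigenvalues_eq_finrank_of_definite {A : Matrix ι ι ℂ} (hA : A.IsHermitian)
    {P N : Submodule ℂ (ι → ℂ)} (hPN : IsCompl P N)
    (hpos : ∀ p ∈ P, p ≠ 0 → 0 < (star p ⬝ᵥ A *ᵥ p).re) (hneg : ∀ q ∈ N, q ≠ 0 → (star q ⬝ᵥ A *ᵥ q).re < 0) :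
    (Finset.univ.filter fun i => 0 < hA.eigenvalues i).card = Module.finrank ℂ P := by
  classical
  set U : Matrix ι ι ℂ := (hA.eigenvectorUnitary : Matrix ι ι ℂ) with hUdef
  -- the spectral theorem: `Uᴴ A U = diag λ`, `U Uᴴ = 1`
  have hU : Uᴴ * A * U = Matrix.diagonal (RCLike.ofReal ∘ hA.eigenvalues) := by
    have h := hA.conjStarAlgAut_star_eigenvectorUnitary
    rw [Unitary.conjStarAlgAut_star_apply, Matrix.star_eq_conjTranspose] at h
    exact h
  have hUU : U * Uᴴ = 1 := by
    have h := Unitary.coe_mul_star_self hA.eigenvectorUnitary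
    rwa [Unitary.coe_star, Matrix.star_eq_conjTranspose] at h
  -- `dim P ≤ #{λ > 0}`
  have h1 : Module.finrank ℂ P ≤ (Finset.univ.filter fun i => 0 < hA.eigenvalues i).card := by
    have h := finrank_le_card_pos_re_of_pos_on hU hUU hpos
    rwa [Landherr.card_pos_re_ofReal] at h
  -- `dim N ≤ #{λ < 0}` (the inequality for `-A`)
  have hU' : Uᴴ * (-A) * U = Matrix.diagonal fun i => -((RCLike.ofReal ∘ hA.eigenvalues) i : ℂ) := by
    rw [Matrix.mul_neg, Matrix.neg_mul, hU, ← Matrix.diagonal_neg]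
  have hneg' : ∀ q ∈ N, q ≠ 0 → 0 < (star q ⬝ᵥ (-A) *ᵥ q).re := by
    intro q hq hq0
    rw [Matrix.neg_mulVec, dotProduct_neg, Complex.neg_re]
    exact neg_pos.2 (hneg q hq hq0)
  have h2 : Module.finrank ℂ N ≤ (Finset.univ.filter fun i => hA.eigenvalues i < 0).card := by
    have h := finrank_le_card_pos_re_of_pos_on hU' hUU hneg'
    simp only [Function.comp_apply, Complex.neg_re, Landherr.re_rclike_ofReal, neg_pos] at h
    exact h
  -- counting: `dim P + dim N = |ι| ≥ #{λ > 0} + #{λ < 0}`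
  have hsum : Module.finrank ℂ P + Module.finrank ℂ N = Fintype.card ι := by
    have h := Submodule.finrank_sup_add_finrank_inf_eq P N
    rw [hPN.sup_eq_top, hPN.inf_eq_bot, finrank_top, finrank_bot, add_zero, Module.finrank_fintype_fun_eq_card] at h
    exact h.symm
  have hdisj : (Finset.univ.filter fun i => 0 < hA.eigenvalues i).card +
      (Finset.univ.filter fun i => hA.eigenvalues i < 0).card ≤ Fintype.card ι := by
    rw [← Finset.card_union_of_disjoint (Finset.disjoint_filter.2 fun i _ h1 h2 => lt_asymm h1 h2)]
    exact Finset.card_le_univ _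
  omega

end Inertia

/-! ### §4 Landherr's signature invariant on the carriers -/

section Uniqueness

open Matrix

variable {d : ℕ} [Fact (Irreducible (X ^ 2 + C (d : ℚ) : ℚ[X]))] [IsCMField (weilField d)]

/-- **Lemma 5.2 (4) in Landherr's format: at every complex embedding `τ` of `K_d` the Hermitian complex
matrix `τ(Ψ)` of a Gram witness of a Weil-type member has exactly `n` positive eigenvalues.**
[cite: vanGeemen1994HodgeAV, Lemma 5.2 (4)] [cite: Landherr1936HermitianForms] -/
theorem card_pos_eigenvalues_map_weilGram {A : AbelianVariety ℂ} {φ : A ⟶ A} {n m : ℕ}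
    (hd : 0 < d) (hA : A.dim = 2 * n) (hφ : φ ≫ φ = -(d • 𝟙 A)) (hmn : 2 * n = m + 1)
    (hP : Module.finrank ℂ ↥(Module.End.eigenspace (complexBetti.map φ.hom.hom.hom 1).hom
      (Complex.I * (Real.sqrt d : ℂ)) ⊓ hodgeOneZero (Motives.isSmoothProjective_of_dim_eq' hA)) = n)
    (hP' : Module.finrank ℂ ↥(Module.End.eigenspace (complexBetti.map φ.hom.hom.hom 1).hom
      (-(Complex.I * (Real.sqrt d : ℂ))) ⊓ hodgeOneZero (Motives.isSmoothProjective_of_dim_eq' hA)) = n)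
    (e : ProjectiveEmbedding A.X) {a : complexBetti (projectiveSpace e.n ℂ) 2} (haQ : IsRationalClass a) (ha0 : a ≠ 0)
    (x : Fin (2 * n) → complexBetti A.X 1) (ω : complexBetti A.X (2 + 2 * m))
    (am bm : Matrix (Fin (2 * n)) (Fin (2 * n)) ℚ) (hx : ∀ i, IsRationalClass (x i))
    (hind : LinearIndependent ℂ (Sum.elim x (fun i => complexBetti.map φ.hom.hom.hom 1 (x i))))
    (hω : IsRationalClass ω) (hω0 : ω ≠ 0)
    (hQ : ∀ i j, polarizationPairingOne A.X
          ((d : ℂ) • complexBetti.map e.ι 2 a + complexBetti.map φ.hom.hom.hom 2 (complexBetti.map e.ι 2 a)) m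
          (x i) (complexBetti.map φ.hom.hom.hom 1 (x j)) = ((am i j : ℚ) : ℂ) • ω ∧
        polarizationPairingOne A.X
          ((d : ℂ) • complexBetti.map e.ι 2 a + complexBetti.map φ.hom.hom.hom 2 (complexBetti.map e.ι 2 a)) m
          (x i) (x j) = ((bm i j : ℚ) : ℂ) • ω)
    (hΨ : (weilGramMatrix d am bm).transpose.map (IsCMField.complexConj (weilField d)) = weilGramMatrix d am bm)
    (τ : weilField d →+* ℂ) :
    (Finset.univ.filter fun i => 0 < (Landherr.isHermitian_map (weilField d) hΨ τ).eigenvalues i).card = n := by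
  classical
  obtain ⟨P, N, hPN, hfinP, -, hpos, hneg⟩ :=
    exists_definite_splitting_map_weilGram hd hA hφ hmn hP hP' e haQ ha0 x ω am bm hx hind hω hω0 hQ τ
  rw [card_pos_eigenvalues_eq_finrank_of_definite _ hPN hpos hneg, hfinP]

omit [Fact (Irreducible (X ^ 2 + C (d : ℚ) : ℚ[X]))] [IsCMField (weilField d)] in
/-- For a Weil-type `(A, φ)` (`HodgeTheory.IsWeilType`: `i√d` of multiplicity `n` on `H^{1,0}`) the conjugate
eigenvalue `-i√d` also has multiplicity `n` on `H^{1,0}` (`dim_ℂ (V_{-i√d} ∩ H^{1,0}) = dim_ℂ (V_{i√d} ∩ H^{0,1})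
= 2n - n`). [cite: vanGeemen1994HodgeAV, 4.9 and Lemma 5.2 (4)] -/
theorem weilMultiplicity_neg_of_isWeilType {A : AbelianVariety ℂ} {φ : A ⟶ A} {n : ℕ} (hW : IsWeilType A φ n d) :
    Module.finrank ℂ ↥(Module.End.eigenspace (complexBetti.map φ.hom.hom.hom 1).hom
      (-(Complex.I * (Real.sqrt d : ℂ))) ⊓ hodgeOneZero (Motives.isSmoothProjective_of_dim_eq' hW.dim_eq)) = n := by
  haveI := finite_complexBetti_abelianVariety A 1
  have ha := hW.multiplicity_eq
  have hab := finrank_inf_hodgeOneZero_add_finrank_inf_hodgeZeroOne hW.dim_eq hW.d_pos hW.sq_eq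
  rw [ha] at hab
  have hb : Module.finrank ℂ ↥(Module.End.eigenspace (complexBetti.map φ.hom.hom.hom 1).hom
      (Complex.I * (Real.sqrt (d : ℝ) : ℂ)) ⊓ hodgeZeroOne (Motives.isSmoothProjective_of_dim_eq' hW.dim_eq)) = n := by
    omega
  have hconj : (starRingEnd ℂ) (-(Complex.I * (Real.sqrt (d : ℝ) : ℂ))) = Complex.I * (Real.sqrt (d : ℝ) : ℂ) := by
    rw [map_neg, map_mul, Complex.conj_I, Complex.conj_ofReal]; ring
  have h := finrank_eigenspace_inf_hodgeZeroOne_eq (Motives.isSmoothProjective_of_dim_eq' hW.dim_eq) φ.hom.hom.hom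
    (-(Complex.I * (Real.sqrt (d : ℝ) : ℂ)))
  rw [hconj, hb] at h
  exact h.symm

/-! ### §6 Uniqueness -/

/-- **Van Geemen's Lemma 5.2 (3)–(4) with (5.4.1) (after Landherr), on the carriers: UNIQUENESS.**  Let
`(A, φ)` and `(A', φ')` be of Weil type `(n, d)` (`HodgeTheory.IsWeilType`), `e`, `e'` projective embeddings,
`a`, `a'` non-zero rational hyperplane data, `h_K = d·e^*a + φ^*e^*a`, `h'_K` likewise, and let
`(x, ω, a, b, q)`, `(x', ω', a', b', q')` be Gram witnesses (the data of `VanGeemen1994.HasWeilDiscriminantNondeg`: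
`K`-frames of rational classes, `Q(x_i, φ^*x_j) = a_ij ω`, `Q(x_i, x_j) = b_ij ω`, `det Ψ = q`) whose discriminant
classes AGREE in `ℚ^×/Nm(K_d^×)`.  Then the Hermitian Gram matrices are congruent over `K_d`:
`ᵗ(σg) · Ψ · g = Ψ'` for some `g ∈ GL_{2n}(K_d)` — the two Hermitian `K_d`-spaces `(H¹(A, ℚ), H)` and
`(H¹(A', ℚ), H')` are isometric ("classified by `ℚ^×/Nm(K^×)`", (5.4.1)).  Landherr's theorem is the tree's
`hermitianMatrices_congruent_iff_invariants_fin`; its two invariants are supplied by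
`card_pos_eigenvalues_map_weilGram` (signature `(n, n)` at both embeddings, Hodge–Riemann) and
`exists_det_eq_det_mul_norm_of_mk_eq`.  (Instances: `fact_irreducible_weilPoly hd`, `isCMField_weilField`.)
[cite: vanGeemen1994HodgeAV, Lemma 5.2 (3)–(4) and (5.4.1)] [cite: Landherr1936HermitianForms] -/
theorem exists_gl_conjTranspose_mul_weilGram_mul_eq {A A' : AbelianVariety ℂ} {φ : A ⟶ A} {φ' : A' ⟶ A'}
    {n m : ℕ} (hW : IsWeilType A φ n d) (hW' : IsWeilType A' φ' n d) (hmn : 2 * n = m + 1)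
    (e : ProjectiveEmbedding A.X) {a : complexBetti (projectiveSpace e.n ℂ) 2} (haQ : IsRationalClass a) (ha0 : a ≠ 0)
    (x : Fin (2 * n) → complexBetti A.X 1) (ω : complexBetti A.X (2 + 2 * m))
    (am bm : Matrix (Fin (2 * n)) (Fin (2 * n)) ℚ) (q : ℚˣ) (hx : ∀ i, IsRationalClass (x i))
    (hind : LinearIndependent ℂ (Sum.elim x (fun i => complexBetti.map φ.hom.hom.hom 1 (x i))))
    (hω : IsRationalClass ω) (hω0 : ω ≠ 0)
    (hQ : ∀ i j, polarizationPairingOne A.X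
          ((d : ℂ) • complexBetti.map e.ι 2 a + complexBetti.map φ.hom.hom.hom 2 (complexBetti.map e.ι 2 a)) m
          (x i) (complexBetti.map φ.hom.hom.hom 1 (x j)) = ((am i j : ℚ) : ℂ) • ω ∧
        polarizationPairingOne A.X
          ((d : ℂ) • complexBetti.map e.ι 2 a + complexBetti.map φ.hom.hom.hom 2 (complexBetti.map e.ι 2 a)) m
          (x i) (x j) = ((bm i j : ℚ) : ℂ) • ω)
    (hdet : (weilGramMatrix d am bm).det = algebraMap ℚ (weilField d) (q : ℚ))
    (e' : ProjectiveEmbedding A'.X) {a' : complexBetti (projectiveSpace e'.n ℂ) 2} (ha'Q : IsRationalClass a')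
    (ha'0 : a' ≠ 0)
    (x' : Fin (2 * n) → complexBetti A'.X 1) (ω' : complexBetti A'.X (2 + 2 * m))
    (am' bm' : Matrix (Fin (2 * n)) (Fin (2 * n)) ℚ) (q' : ℚˣ) (hx' : ∀ i, IsRationalClass (x' i))
    (hind' : LinearIndependent ℂ (Sum.elim x' (fun i => complexBetti.map φ'.hom.hom.hom 1 (x' i))))
    (hω' : IsRationalClass ω') (hω'0 : ω' ≠ 0)
    (hQ' : ∀ i j, polarizationPairingOne A'.X
          ((d : ℂ) • complexBetti.map e'.ι 2 a' + complexBetti.map φ'.hom.hom.hom 2 (complexBetti.map e'.ι 2 a')) m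
          (x' i) (complexBetti.map φ'.hom.hom.hom 1 (x' j)) = ((am' i j : ℚ) : ℂ) • ω' ∧
        polarizationPairingOne A'.X
          ((d : ℂ) • complexBetti.map e'.ι 2 a' + complexBetti.map φ'.hom.hom.hom 2 (complexBetti.map e'.ι 2 a')) m
          (x' i) (x' j) = ((bm' i j : ℚ) : ℂ) • ω')
    (hdet' : (weilGramMatrix d am' bm').det = algebraMap ℚ (weilField d) (q' : ℚ))
    (hqq : (QuotientGroup.mk q : weilNormResidueGroup d) = QuotientGroup.mk q') :
    ∃ g : GL (Fin (2 * n)) (weilField d),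
      ((g : Matrix (Fin (2 * n)) (Fin (2 * n)) (weilField d)).transpose.map (IsCMField.complexConj (weilField d))) *
          weilGramMatrix d am bm * (g : Matrix (Fin (2 * n)) (Fin (2 * n)) (weilField d)) =
        weilGramMatrix d am' bm' := by
  classical
  have hd : 0 < d := hW.d_pos
  obtain ⟨has, hbs⟩ := weilGram_coeff_symm hd (hW.dim_eq.trans hmn) hW.sq_eq e a x hω0 hQ
  obtain ⟨has', hbs'⟩ := weilGram_coeff_symm hd (hW'.dim_eq.trans hmn) hW'.sq_eq e' a' x' hω'0 hQ'
  have hΨ := conjTranspose_weilGramMatrix (d := d) has hbs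
  have hΨ' := conjTranspose_weilGramMatrix (d := d) has' hbs'
  have h0 : (weilGramMatrix d am bm).det ≠ 0 := by
    rw [hdet]; exact (map_ne_zero (algebraMap ℚ (weilField d))).2 q.ne_zero
  have h0' : (weilGramMatrix d am' bm').det ≠ 0 := by
    rw [hdet']; exact (map_ne_zero (algebraMap ℚ (weilField d))).2 q'.ne_zero
  refine (hermitianMatrices_congruent_iff_invariants_fin (weilField d) (2 * n) _ _ hΨ hΨ' h0 h0').2 ⟨fun τ => ?_, ?_⟩
  · rw [card_pos_eigenvalues_map_weilGram hd hW.dim_eq hW.sq_eq hmn hW.multiplicity_eq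
        (weilMultiplicity_neg_of_isWeilType hW) e haQ ha0 x ω am bm hx hind hω hω0 hQ hΨ τ,
      card_pos_eigenvalues_map_weilGram hd hW'.dim_eq hW'.sq_eq hmn hW'.multiplicity_eq
        (weilMultiplicity_neg_of_isWeilType hW') e' ha'Q ha'0 x' ω' am' bm' hx' hind' hω' hω'0 hQ' hΨ' τ]
  · exact exists_det_eq_det_mul_norm_of_mk_eq hdet hdet' hqq

end Uniqueness

end Summit.HodgeConjecture.HodgeConjecture.Ring2.AbelianAll

end
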